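import Summits.QuantumAdvantage.AdviceFreeQNC0.WindowLocalHard
import Summits.QuantumAdvantage.AdviceFreeQNC0.WalkTransport
import HarnessLib

/-!
# Cell qa-qnc0 — after (NP₁): the MINIMAL OPEN CLASS for the crux `RingHardOdd 3`, and the
# FREE-WINDOW THEOREM for gated strategies

(Part A of two.) Cell qa-qnc0, crux stmt-QuantumAdvantage-22907.  AUTHORED AND PROVED BY THE PLANNER qa-qnc0-p1 gen 36 (ROUND-35 §4.10 (5), evidence #47 on stmt-22907, file `HOME/qa-qnc0-p1/exp36/GatedLocal37.lean` v2, 469 lines, rc 0 / 0 sorries); landed verbatim by qn-prover-3 g21 as a two-way split: `GatedCrossFree37` (Part A, namespace `AdviceFreeQNC0`) → `GatedLocal37` (Part B, namespace `AffBells37G`).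

Planner qa-qnc0-p1 gen 36, ROUND-35 §4.10.  In the tree: LOCAL rules lose a constant fraction
(`windowLocalHardU`, any complexity), tables reading a COMMON set `W` (`3|W| ≤ N`) plus polylog-local bits lose a
constant fraction (`AffBells34.coverPolylogHard`), sparse deviations from the canonical guess lose (`RingBShot3`),
and every AFFINE strategy loses `N^{-e}` (p2's `AffBells37.affBellsPolyLoss3`, (NP₁)).  The smallest class of legal
polylog-degree 𝔽₃ strategies covered by none of these is GATED-LOCAL: local rules that may also read the values of a
few GLOBAL 𝔽₃-linear forms of the input (`[ℓ(x) = s]` has 𝔽₃-degree 2, so `k` gates of window-`r` tables have degree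
`≤ 2k + 2r + 1`).

## Part A (namespace `AdviceFreeQNC0`, PROVED): gating by information that lives off a cross-free window is free

* `ringWinU_glue3_fibre_le` — the fibrewise form of the cross-free window theorem (the bound per outside content
  `(a, b)`, extracted from the proof of `ringWinU_crossFree_sqrt_le`);
* `ringWinU_gated_sqrt_le`, `ringWinU_gated_crossFree_le` — **GATED CROSS-FREE WINDOW THEOREM**: a strategy
  `y g u = G (σ u) g u` whose SELECTOR OF STRATEGIES `σ` (values in any finite type: MOD-3 gates, arbitrary registers,
  anything) does not read the window, and whose every branch `G t` satisfies the hypotheses of the cross-free window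
  theorem, wins on at most `θ·2ⁿ` inputs — the same `θ`.  (Section identity + Fubini: inside each section the branch
  is a fixed low-degree cross-free strategy and the section is a union of fibres.)  The gated strategy itself may have
  full 𝔽₂-degree.
* `ringWinU_gatedLocal_le` — **GATED LOCAL RULES**: window-local branches (`WindowLocal (log₂ n)^C`) selected by any
  `σ` that ignores some stretch `[p, p + gfree n C)` of `gfree n C = 2(log₂ n)^{2C+3} + 2(log₂ n)^{C+1}` consecutive
  bits: at most `θ·2ⁿ` wins, one `θ < 1` for all `C`.

## Part B (namespace `AffBells37G`): the rung and what Part A leaves of it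

* `gateVal ℓ u`, `GatedLocal r k y`, `GatedLocalHardU k`, `sectionWins`, `card_wins_gated` (section identity),
  `SectionLocalHardU k`, `gatedLocalHardU_of_section` — as in v1;
* `gatedLocal_freeWindow_le`, `sectionWins_freeWindow_le` — **PROVED CASE OF THE RUNG**: if the gate forms `ℓ_i`
  all vanish on some stretch of `gfree n C + 1` consecutive positions, the gated-local strategy loses a constant
  fraction.  Hence `GatedLocalHardU k` / `SectionLocalHardU k` are OPEN ONLY FOR POLYLOG-DENSE GATES (every stretch of
  `gfree n C + 1` positions meets `⋃ supp ℓ_i`), e.g. `ℓ = Σ_j x_j`; there the section condition enters the window and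
  the missing statement is a CROSS-CELL OBSTRUCTION WITH EXCHANGED LOCAL TRITS (memo §4.10 (5)): in
  `crossCell_obstruction` let the arbitrary triples `A_ρ(x)`, `B_σ(z)` depend additionally on one trit `τ_z(z)` resp.
  `τ_x(x)` computed on the OTHER half (`τ` arbitrary functions into `ZMod 3`).

WHAT THIS IS NOT: no bound for dense gates; crux untouched.  K-106 (kit j331792/j331794/j331816/j331817): no numerical
sign that one dense MOD-3 gate lifts local rules above 2/3 asymptotically (best excess +0.16, +0.078, +0.037, +0.0098 at
N = 11, 13, 15, 17; search lower bounds).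
-/

noncomputable section

namespace Summit.QuantumAdvantage.AdviceFreeQNC0

open Finset
open Literature.Computability.MetaComplexity Literature.Computability.MetaComplexity.Smolensky

/-! ### Part A.0 — bookkeeping copied from `CrossFreeWindowPolylog` (private there) -/

/-- Bookkeeping: `k^C ≤ c₁·√L` when `1 ≤ c₁√k` and `k^{2C+1} ≤ L`. -/
private theorem pow_le_mul_sqrt₂ {c₁ : ℝ} (hc₁ : 0 < c₁) {k C L : ℕ} (hck : 1 ≤ c₁ * Real.sqrt k)
    (hL : k ^ (2 * C + 1) ≤ L) : ((k ^ C : ℕ) : ℝ) ≤ c₁ * Real.sqrt L := by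
  have hsqrt : (k : ℝ) ^ C * Real.sqrt k ≤ Real.sqrt L := by
    have h2 : ((k ^ (2 * C + 1) : ℕ) : ℝ) ≤ L := by exact_mod_cast hL
    have h1 : ((k : ℝ) ^ C) ^ 2 * k ≤ L := by
      calc ((k : ℝ) ^ C) ^ 2 * k = (k : ℝ) ^ (2 * C + 1) := by ring
        _ ≤ L := by push_cast at h2; exact h2
    calc (k : ℝ) ^ C * Real.sqrt k = Real.sqrt (((k : ℝ) ^ C) ^ 2 * k) := by
          rw [Real.sqrt_mul (by positivity), Real.sqrt_sq (by positivity)]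
      _ ≤ Real.sqrt L := Real.sqrt_le_sqrt h1
  push_cast
  calc (k : ℝ) ^ C = (k : ℝ) ^ C * 1 := (mul_one _).symm
    _ ≤ (k : ℝ) ^ C * (c₁ * Real.sqrt k) := mul_le_mul_of_nonneg_left hck (by positivity)
    _ = c₁ * ((k : ℝ) ^ C * Real.sqrt k) := by ring
    _ ≤ c₁ * Real.sqrt L := mul_le_mul_of_nonneg_left hsqrt hc₁.le

/-- Bookkeeping: `1 ≤ c₁·√k` once `k ≥ ⌈1/c₁²⌉ + 1`. -/
private theorem one_le_mul_sqrt₂ {c₁ : ℝ} (hc₁ : 0 < c₁) {k : ℕ} (hk : ⌈1 / c₁ ^ 2⌉₊ + 1 ≤ k) :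
    1 ≤ c₁ * Real.sqrt k := by
  have h2 : ((⌈1 / c₁ ^ 2⌉₊ : ℕ) : ℝ) + 1 ≤ k := by exact_mod_cast hk
  have h3 : (1 / c₁ ^ 2 : ℝ) ≤ ((⌈1 / c₁ ^ 2⌉₊ : ℕ) : ℝ) := Nat.le_ceil _
  have h1 : (1 / c₁ ^ 2 : ℝ) ≤ k := by linarith
  rw [div_le_iff₀ (by positivity)] at h1
  calc (1 : ℝ) = Real.sqrt 1 := Real.sqrt_one.symm
    _ ≤ Real.sqrt (c₁ ^ 2 * k) := Real.sqrt_le_sqrt (by linarith)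
    _ = c₁ * Real.sqrt k := by rw [Real.sqrt_mul (by positivity), Real.sqrt_sq hc₁.le]

variable {p m q : ℕ}

/-- Two glued inputs differing only in the middle block agree off the middle block. -/
theorem glue3_eq_off_mid (a : Fin p → Bool) (v v' : Fin m → Bool) (b : Fin q → Bool) (i : Fin (p + m + q))
    (hi : ¬ (p ≤ i.val ∧ i.val < p + m)) : glue3 a v b i = glue3 a v' b i := by
  unfold glue3
  induction i using Fin.addCases with
  | left k =>
    simp only [Fin.append_left]
    induction k using Fin.addCases with
    | left k₀ => simp only [Fin.append_left]
    | right k₁ =>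
      exfalso
      have := k₁.isLt
      simp only [Fin.val_castAdd, Fin.val_natAdd] at hi
      omega
  | right k => simp only [Fin.append_right]

/-! ### Part A.1 — the fibrewise cross-free bound -/

/-- The cross-free window theorem FIBREWISE: for every content `(a, b)` of the bits outside the window, at most
`(1 − η₁)·2^{L+H+M}` window contents win.  (The proof of `ringWinU_crossFree_sqrt_le`, stopped before Fubini.) -/
theorem ringWinU_glue3_fibre_le :
    ∃ η₁ : ℝ, 0 < η₁ ∧ ∃ c₁ : ℝ, 0 < c₁ ∧ ∃ n₀ : ℕ, ∀ p L H M q : ℕ, n₀ ≤ L → n₀ ≤ M →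
      ∀ D : ℕ, (D : ℝ) ≤ c₁ * Real.sqrt L → (D : ℝ) ≤ c₁ * Real.sqrt M →
      ∀ (c : ℕ) (y : Fin (p + (L + H + M) + q + 1) → (Fin (p + (L + H + M) + q) → Bool) → Bool),
        (∀ g, HasDeg (y g) D) →
        (∀ g : Fin (p + (L + H + M) + q + 1), p < g.val → g.val < p + L →
          ∀ (a : Fin p → Bool) (x : Fin L → Bool) (h : Fin H → Bool) (z z' : Fin M → Bool)
            (b : Fin q → Bool), y g (glue3 a (glue3 x h z) b) = y g (glue3 a (glue3 x h z') b)) →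
        (∀ g : Fin (p + (L + H + M) + q + 1), p + (L + H) < g.val → g.val < p + (L + H + M) →
          ∀ (a : Fin p → Bool) (x x' : Fin L → Bool) (h : Fin H → Bool) (z : Fin M → Bool)
            (b : Fin q → Bool), y g (glue3 a (glue3 x h z) b) = y g (glue3 a (glue3 x' h z) b)) →
        ∀ (a : Fin p → Bool) (b : Fin q → Bool),
          ((univ.filter fun v : Fin (L + H + M) → Bool => ringWinU c y (glue3 a v b) = true).card : ℝ) ≤
            (1 - η₁) * (2 : ℝ) ^ (L + H + M) := by
  obtain ⟨η₁, hη₁, c₁, hc₁, n₀, Hmix⟩ := mixedWinU_crossFree_le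
  refine ⟨η₁, hη₁, c₁, hc₁, n₀, ?_⟩
  intro p L H M q hL hM D hDL hDM c y hdeg hX hZ a b
  have heq : (univ.filter fun v : Fin (L + H + M) → Bool => ringWinU c y (glue3 a v b) = true) =
      univ.filter fun v : Fin (L + H + M) → Bool =>
        mixedWinU (inCharge c a b) (outParity y c a b) (inStrategy y a b) v = true :=
    Finset.filter_congr fun v _ => by rw [ringWinU_glue3_eq_mixedWinU]
  rw [heq]
  refine Hmix L H M hL hM D hDL hDM (inCharge c a b) (outParity y c a b) (inStrategy y a b)
    (hasDeg_outParity c y hdeg a b) (fun v => outParity_even c y a b v)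
    (hasDeg_inStrategy y hdeg a b) ?_ ?_
  · intro g' h1 h2 x h z z'
    exact hX ⟨p + g'.val, by omega⟩ (show p < p + g'.val by omega)
      (show p + g'.val < p + L by omega) a x h z z' b
  · intro g' h1 h2 x x' h z
    exact hZ ⟨p + g'.val, by omega⟩ (show p + (L + H) < p + g'.val by omega)
      (show p + g'.val < p + (L + H + M) by omega) a x x' h z b

/-! ### Part A.2 — gated strategies, window coordinates -/

/-- **GATED CROSS-FREE WINDOW THEOREM (square-root form).**  `y g u = G (σ u) g u`: the selector `σ` (any finite
codomain) does not read the window; each branch `G t` is a degree-`D` strategy for which the window is cross-free.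
Then `y` wins on at most `(1 − η₁)·2ⁿ` inputs. -/
theorem ringWinU_gated_sqrt_le :
    ∃ θ : ℝ, θ < 1 ∧ ∃ c₁ : ℝ, 0 < c₁ ∧ ∃ n₀ : ℕ, ∀ p L H M q : ℕ, n₀ ≤ L → n₀ ≤ M →
      ∀ D : ℕ, (D : ℝ) ≤ c₁ * Real.sqrt L → (D : ℝ) ≤ c₁ * Real.sqrt M →
      ∀ (c : ℕ) (T : Type) [Fintype T] [DecidableEq T]
        (σ : (Fin (p + (L + H + M) + q) → Bool) → T)
        (G : T → Fin (p + (L + H + M) + q + 1) → (Fin (p + (L + H + M) + q) → Bool) → Bool),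
        (∀ (a : Fin p → Bool) (v v' : Fin (L + H + M) → Bool) (b : Fin q → Bool),
          σ (glue3 a v b) = σ (glue3 a v' b)) →
        (∀ t g, HasDeg (G t g) D) →
        (∀ t, ∀ g : Fin (p + (L + H + M) + q + 1), p < g.val → g.val < p + L →
          ∀ (a : Fin p → Bool) (x : Fin L → Bool) (h : Fin H → Bool) (z z' : Fin M → Bool)
            (b : Fin q → Bool), G t g (glue3 a (glue3 x h z) b) = G t g (glue3 a (glue3 x h z') b)) →
        (∀ t, ∀ g : Fin (p + (L + H + M) + q + 1), p + (L + H) < g.val → g.val < p + (L + H + M) →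
          ∀ (a : Fin p → Bool) (x x' : Fin L → Bool) (h : Fin H → Bool) (z : Fin M → Bool)
            (b : Fin q → Bool), G t g (glue3 a (glue3 x h z) b) = G t g (glue3 a (glue3 x' h z) b)) →
        ((univ.filter fun u : Fin (p + (L + H + M) + q) → Bool =>
            ringWinU c (fun g u => G (σ u) g u) u = true).card : ℝ) ≤
          θ * (2 : ℝ) ^ (p + (L + H + M) + q) := by
  obtain ⟨η₁, hη₁, c₁, hc₁, n₀, Hfib⟩ := ringWinU_glue3_fibre_le
  refine ⟨1 - η₁, by linarith, c₁, hc₁, n₀, ?_⟩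
  intro p L H M q hL hM D hDL hDM c T _ _ σ G hσ hdeg hX hZ
  -- the section identity
  have hsec : (univ.filter fun u : Fin (p + (L + H + M) + q) → Bool =>
        ringWinU c (fun g u => G (σ u) g u) u = true).card =
      ∑ t : T, (univ.filter fun u : Fin (p + (L + H + M) + q) → Bool =>
        σ u = t ∧ ringWinU c (G t) u = true).card := by
    rw [← Finset.card_biUnion]
    · congr 1
      ext u
      simp only [mem_filter, mem_univ, true_and, mem_biUnion]
      have hsame : ringWinU c (G (σ u)) u = ringWinU c (fun g u => G (σ u) g u) u := by
        unfold ringWinU; rfl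
      constructor
      · intro h
        exact ⟨σ u, rfl, by rw [hsame]; exact h⟩
      · rintro ⟨t, ht, h⟩
        subst ht
        rw [← hsame]; exact h
    · intro s _ s' _ hne
      rw [Function.onFun, disjoint_filter]
      intro u _ h1 h2
      exact hne (h1.1.symm.trans h2.1)
  rw [hsec]
  push_cast
  set v₀ : Fin (L + H + M) → Bool := fun _ => false with hv₀
  have hper : ∀ t : T, ((univ.filter fun u : Fin (p + (L + H + M) + q) → Bool =>
        σ u = t ∧ ringWinU c (G t) u = true).card : ℝ) ≤
      ∑ a : Fin p → Bool, ∑ b : Fin q → Bool,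
        (if σ (glue3 a v₀ b) = t then (1 - η₁) * (2 : ℝ) ^ (L + H + M) else 0) := by
    intro t
    rw [card_filter_eq_sum_glue3]
    push_cast
    refine Finset.sum_le_sum fun a _ => Finset.sum_le_sum fun b _ => ?_
    by_cases hab : σ (glue3 a v₀ b) = t
    · rw [if_pos hab]
      have heq : (univ.filter fun v : Fin (L + H + M) → Bool =>
            σ (glue3 a v b) = t ∧ ringWinU c (G t) (glue3 a v b) = true) =
          univ.filter fun v : Fin (L + H + M) → Bool => ringWinU c (G t) (glue3 a v b) = true := by
        refine Finset.filter_congr fun v _ => ?_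
        rw [hσ a v v₀ b]
        exact ⟨fun h => h.2, fun h => ⟨hab, h⟩⟩
      rw [heq]
      exact Hfib p L H M q hL hM D hDL hDM c (G t) (hdeg t) (hX t) (hZ t) a b
    · rw [if_neg hab]
      have heq : (univ.filter fun v : Fin (L + H + M) → Bool =>
            σ (glue3 a v b) = t ∧ ringWinU c (G t) (glue3 a v b) = true) = ∅ := by
        refine Finset.filter_eq_empty_iff.2 fun v _ h => hab ?_
        rw [← hσ a v v₀ b]
        exact h.1
      rw [heq, card_empty]
      simp
  calc ∑ t : T, ((univ.filter fun u : Fin (p + (L + H + M) + q) → Bool =>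
          σ u = t ∧ ringWinU c (G t) u = true).card : ℝ)
      ≤ ∑ t : T, ∑ a : Fin p → Bool, ∑ b : Fin q → Bool,
          (if σ (glue3 a v₀ b) = t then (1 - η₁) * (2 : ℝ) ^ (L + H + M) else 0) :=
        Finset.sum_le_sum fun t _ => hper t
    _ = ∑ a : Fin p → Bool, ∑ b : Fin q → Bool, ∑ t : T,
          (if σ (glue3 a v₀ b) = t then (1 - η₁) * (2 : ℝ) ^ (L + H + M) else 0) := by
        rw [Finset.sum_comm]
        refine Finset.sum_congr rfl fun a _ => ?_
        rw [Finset.sum_comm]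
    _ = ∑ _a : Fin p → Bool, ∑ _b : Fin q → Bool, (1 - η₁) * (2 : ℝ) ^ (L + H + M) := by
        refine Finset.sum_congr rfl fun a _ => Finset.sum_congr rfl fun b _ => ?_
        rw [Finset.sum_ite_eq]
        simp
    _ = (1 - η₁) * (2 : ℝ) ^ (p + (L + H + M) + q) := by
        simp only [Finset.sum_const, Finset.card_univ, Fintype.card_fun, Fintype.card_bool,
          Fintype.card_fin, nsmul_eq_mul]
        push_cast
        ring

/-! ### Part A.3 — polylog form, general `n` -/

/-- **GATED CROSS-FREE WINDOW THEOREM (polylog form).**  As `ringWinU_crossFree_le`, for strategies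
`y g u = G (σ u) g u` with a selector `σ` that ignores the window and branches `G t` of degree `≤ (log₂ n)^C` for which
the window is cross-free. -/
theorem ringWinU_gated_crossFree_le :
    ∃ θ : ℝ, θ < 1 ∧ ∀ C : ℕ, ∃ n₀ : ℕ, ∀ n ≥ n₀, ∀ p L H M : ℕ, p + (L + H + M) ≤ n →
      (Nat.log 2 n) ^ (2 * C + 1) ≤ L → (Nat.log 2 n) ^ (2 * C + 1) ≤ M →
      ∀ (c : ℕ) (T : Type) [Fintype T] [DecidableEq T] (σ : (Fin n → Bool) → T)
        (G : T → Fin (n + 1) → (Fin n → Bool) → Bool),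
        (∀ u u' : Fin n → Bool,
          (∀ i : Fin n, ¬ (p ≤ i.val ∧ i.val < p + (L + H + M)) → u i = u' i) → σ u = σ u') →
        (∀ t g, HasDeg (G t g) ((Nat.log 2 n) ^ C)) →
        (∀ t, ∀ g : Fin (n + 1), p < g.val → g.val < p + L → ∀ u u' : Fin n → Bool,
          (∀ i : Fin n, ¬ (p + (L + H) ≤ i.val ∧ i.val < p + (L + H + M)) → u i = u' i) →
          G t g u = G t g u') →
        (∀ t, ∀ g : Fin (n + 1), p + (L + H) < g.val → g.val < p + (L + H + M) → ∀ u u' : Fin n → Bool,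
          (∀ i : Fin n, ¬ (p ≤ i.val ∧ i.val < p + L) → u i = u' i) → G t g u = G t g u') →
          ((univ.filter fun u : Fin n → Bool =>
              ringWinU c (fun g u => G (σ u) g u) u = true).card : ℝ) ≤ θ * (2 : ℝ) ^ n := by
  obtain ⟨θ, hθ, c₁, hc₁, ℓ₀, Hsq⟩ := ringWinU_gated_sqrt_le
  refine ⟨θ, hθ, fun C => ⟨2 ^ (max (ℓ₀ + 1) (⌈1 / c₁ ^ 2⌉₊ + 1)), ?_⟩⟩
  intro n hn p L H M hpn hL hM c T _ _ σ G hσ hdeg hX hZ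
  obtain ⟨q, rfl⟩ : ∃ q, n = p + (L + H + M) + q := ⟨n - (p + (L + H + M)), by omega⟩
  set k := Nat.log 2 (p + (L + H + M) + q) with hk
  have hm : max (ℓ₀ + 1) (⌈1 / c₁ ^ 2⌉₊ + 1) ≤ k := Nat.le_log_of_pow_le one_lt_two hn
  have hkℓ : ℓ₀ + 1 ≤ k := le_trans (le_max_left _ _) hm
  have hk1 : ⌈1 / c₁ ^ 2⌉₊ + 1 ≤ k := le_trans (le_max_right _ _) hm
  have hkk : k ≤ k ^ (2 * C + 1) := Nat.le_self_pow (by omega) k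
  have hℓ₀L : ℓ₀ ≤ L := by omega
  have hℓ₀M : ℓ₀ ≤ M := by omega
  have hck := one_le_mul_sqrt₂ hc₁ hk1
  have hDL := pow_le_mul_sqrt₂ (C := C) hc₁ hck hL
  have hDM := pow_le_mul_sqrt₂ (C := C) hc₁ hck hM
  refine Hsq p L H M q hℓ₀L hℓ₀M _ hDL hDM c T σ G ?_ hdeg ?_ ?_
  · intro a v v' b
    exact hσ _ _ fun i hi => glue3_eq_off_mid a v v' b i hi
  · intro t g h1 h2 a x h z z' b
    exact hX t g h1 h2 _ _ fun i hi => glue3_glue3_eq_off_z a x h z z' b i hi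
  · intro t g h1 h2 a x x' h z b
    exact hZ t g h1 h2 _ _ fun i hi => glue3_glue3_eq_off_x a x x' h z b i hi

/-! ### Part A.4 — gated local rules -/

/-- width of the stretch the selector must not read: `2(log₂ n)^{2C+3} + 2(log₂ n)^{C+1}`. -/
def gfree (n C : ℕ) : ℕ := 2 * (Nat.log 2 n) ^ (2 * C + 3) + 2 * (Nat.log 2 n) ^ (C + 1)

/-- **GATED LOCAL RULES.**  One `θ < 1` for all `C`: a strategy `y g u = G (σ u) g u` whose branches are
`(log₂ n)^C`-window-local and whose selector `σ` (arbitrary, any finite codomain — MOD-3 gates, registers, …) ignores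
some stretch `[p, p + gfree n C)` of the input wins the u-walk game, every charge, on at most `θ·2ⁿ` inputs. -/
theorem ringWinU_gatedLocal_le :
    ∃ θ : ℝ, θ < 1 ∧ ∀ C : ℕ, ∃ n₀ : ℕ, ∀ n ≥ n₀, ∀ (c : ℕ) (T : Type) [Fintype T] [DecidableEq T]
      (σ : (Fin n → Bool) → T) (G : T → Fin (n + 1) → (Fin n → Bool) → Bool) (p : ℕ),
        p + gfree n C ≤ n →
        (∀ u u' : Fin n → Bool,
          (∀ i : Fin n, ¬ (p ≤ i.val ∧ i.val < p + gfree n C) → u i = u' i) → σ u = σ u') →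
        (∀ t, WindowLocal ((Nat.log 2 n) ^ C) (G t)) →
          ((univ.filter fun u : Fin n → Bool =>
              ringWinU c (fun g u => G (σ u) g u) u = true).card : ℝ) ≤ θ * (2 : ℝ) ^ n := by
  obtain ⟨θ, hθ, Hpoly⟩ := ringWinU_gated_crossFree_le
  refine ⟨θ, hθ, fun C => ?_⟩
  obtain ⟨n₁, hn₁⟩ := Hpoly (C + 1)
  refine ⟨max n₁ 4, fun n hn c T _ _ σ G p hp hσ hloc => ?_⟩
  have hn₁n : n₁ ≤ n := le_trans (le_max_left _ _) hn
  have hlog : 2 ≤ Nat.log 2 n := Nat.le_log_of_pow_le (by norm_num) (le_trans (le_max_right _ _) hn)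
  have hmono : (Nat.log 2 n) ^ C ≤ (Nat.log 2 n) ^ (C + 1) :=
    Nat.pow_le_pow_right (by omega) (Nat.le_succ C)
  have hdeg2 : 2 * (Nat.log 2 n) ^ C ≤ (Nat.log 2 n) ^ (C + 1) := by
    rw [pow_succ]; nlinarith [Nat.one_le_pow C (Nat.log 2 n) (by omega)]
  have hexp : (Nat.log 2 n) ^ (2 * (C + 1) + 1) = (Nat.log 2 n) ^ (2 * C + 3) := by ring_nf
  have hgf : gfree n C = (Nat.log 2 n) ^ (2 * C + 3) + 2 * (Nat.log 2 n) ^ (C + 1) + (Nat.log 2 n) ^ (2 * C + 3) := by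
    unfold gfree; ring
  -- the window `[p, p + L + H + M)`, `L = M = (log₂ n)^{2C+3}`, `H = 2 (log₂ n)^{C+1}`
  refine hn₁ n hn₁n p ((Nat.log 2 n) ^ (2 * C + 3)) (2 * (Nat.log 2 n) ^ (C + 1)) ((Nat.log 2 n) ^ (2 * C + 3))
    (by rw [← hgf]; exact hp) (by rw [hexp]) (by rw [hexp]) c T σ G ?_ ?_ ?_ ?_
  · intro u u' huu'
    refine hσ u u' fun i hi => huu' i ?_
    rw [hgf] at hi; exact hi
  · intro t g
    exact lowDeg_mono hdeg2 (hasDeg_of_windowLocal (hloc t) g)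
  · intro t g h1 h2 u u' huu'
    refine hloc t g u u' fun i hi1 hi2 => huu' i ?_
    generalize hA : (Nat.log 2 n) ^ (2 * C + 3) = A at h1 h2 hi1 hi2 ⊢
    generalize hB : (Nat.log 2 n) ^ (C + 1) = B at h1 h2 hi1 hi2 ⊢
    have hCB : (Nat.log 2 n) ^ C ≤ B := hB ▸ hmono
    generalize hD : (Nat.log 2 n) ^ C = D at hi1 hi2 hCB
    omega
  · intro t g h1 h2 u u' huu'
    refine hloc t g u u' fun i hi1 hi2 => huu' i ?_
    generalize hA : (Nat.log 2 n) ^ (2 * C + 3) = A at h1 h2 hi1 hi2 ⊢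
    generalize hB : (Nat.log 2 n) ^ (C + 1) = B at h1 h2 hi1 hi2 ⊢
    have hCB : (Nat.log 2 n) ^ C ≤ B := hB ▸ hmono
    generalize hD : (Nat.log 2 n) ^ C = D at hi1 hi2 hCB
    omega

end Summit.QuantumAdvantage.AdviceFreeQNC0
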